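import Summits.ResolutionOfSingularities.ResolutionOfSingularities.Theorems.RadicialJungCleanModelsSufficeGamePointData
import Summits.ResolutionOfSingularities.ResolutionOfSingularities.Theorems.RadicialJungCleanModelsSufficeGamePotential
import Summits.ResolutionOfSingularities.ResolutionOfSingularities.Theorems.RadicialJungCleanModelsSufficeGameCentre1
import Summits.ResolutionOfSingularities.ResolutionOfSingularities.Theorems.RadicialJungCleanModelsSufficeGameCentre2
import Summits.ResolutionOfSingularities.ResolutionOfSingularities.Theorems.RadicialJungCleanModelsSufficeGameEndResolves
import Summits.ResolutionOfSingularities.ResolutionOfSingularities.Theorems.RadicialJungCleanModelsSufficeGameInit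
import Summits.ResolutionOfSingularities.ResolutionOfSingularities.Theorems.RadicialJungCleanModelsSufficeGameRoundOff
import Summits.ResolutionOfSingularities.ResolutionOfSingularities.Theorems.RadicialJungCleanModelsSufficeRoundOver
import Summits.ResolutionOfSingularities.ResolutionOfSingularities.Theorems.RadicialJungCleanModelsSufficeReductionKN
import Literature.AlgebraicGeometry.Resolution.BlowupSNC
import Literature.AlgebraicGeometry.Resolution.BlowupsExistence
import Literature.AlgebraicGeometry.Resolution.BlowupsIntegral
import Literature.AlgebraicGeometry.Resolution.BlowupsProperProofs
import Literature.AlgebraicGeometry.Resolution.AlterationsResolution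
import Literature.AlgebraicGeometry.Resolution.ComponentGluing

/-!
# Crux `CleanModelsSuffice` (stmt-ResolutionOfSingularities-15883), line `Sketch` — skeleton v7 (all game stubs landed; Kato (10.4) left)

Route `ResolutionOfSingularities/RadicialJung`, crux `CleanModelsSuffice` (rank 4):
`∀ p prime, PIAlt_p → CleanModels_p → ResolutionInChar p`. This file proves it CONDITIONALLY on the one
named fact of the line, Kato 1994 (10.4) (`Kato1994_logRegularScheme_hasResolution`: a quasi-compact log
regular scheme with Zariski fs charts has a resolution):

* `CleanModelsSuffice_of_kato : Kato1994_logRegularScheme_hasResolution.{0} → CleanModelsSuffice`.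

Proof (the exceptionalisation GAME, all stubs landed as `…RadicialJungCleanModelsSuffice*` files):
* a pointwise log-clean pair `(V, L)` (`V` regular over `k`, `char k = p`, `L/K(V)` purely inseparable of
  degree `p`, clean presentations `y_v^p = w ∏ u_i^{a_i}` at every point) is an initial `GameState`
  (`stub_gameInit`, `…GameInit`);
* ONE ROUND of the game (`stub_gameRound`, here): blow up an admissible centre (`exists_isBlowup`) and
  rebuild the state point by point — off the centre by transport (`stub_gameRoundOff`, `…GameRoundOff`), over
  the centre by the chart computation (`stub_gameRoundOver`, `…RoundOver*`: labels of the new boundary, the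
  radicand upstairs with the `p`-th-power correction, the REG clause via derivations on the chart, the
  measures incl. the phase-2 resonance arithmetic);
* the CENTRES are closed and admissible: phase 1 `{mOld = max}` (`stub_gameCentre1`, `…GameCentre1`: the
  normalisation-singular locus `S₂` is intrinsic, thresholds `|ch| ≥ 2 ⟺ singular` by Kummer orders and
  derivations over the prime field, germs of closed sets read on `Spec 𝒪_v`, charge constancy of exceptional
  divisors `…GameCharge`, the intrinsic count `…GameCountE`) and phase 2 `W D₀ = {mOld = 1 ∧ D₀ charged}`
  (`stub_gameCentre2`, `…GameCentre2`);
* TERMINATION (`endState_exists`, here): phase 1 by induction on `max mOld` (it drops: `RoundSpec`), phase 2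
  by induction on the potential `Φ` (`GameState.Φ_lt_of_roundSpec`);
* the END STATE is log regular for the boundary of charged exceptional divisors and Kato (10.4) resolves the
  normalisation of the base in `L` (`stub_gameEndResolves`, `…GameEnd*`);
* the frame: `CleanResolves.cleanResolves_of_self` and pAlteration's proved per-prime frame
  (`palterationThesisAt_iff_resolutionInChar`, `picoverAt_of_degPAt`).

History of the line: Kato 1994 (4.1) was ELIMINATED (Kummer normality: `…PIndep`, `…RootOverring`,
`…KummerDescent`, `…KummerNormal`, `…ChartsKN`, `…AdaptedKN`); the earlier "pairwise adapted data" interface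
(`…ReductionKN`) is degenerate at the generic point and is not used by this proof.
-/

noncomputable section

set_option linter.dupNamespace false -- mandated namespace of this single-conjunct summit

open CategoryTheory AlgebraicGeometry TopologicalSpace IsLocalRing
open Literature.AlgebraicGeometry.Resolution Literature.AlgebraicGeometry.Motives

namespace Summit.ResolutionOfSingularities.ResolutionOfSingularities.Theorems.RadicialJung.CleanModelsSuffice


/-! ## The stubs of the game -/






/-- **One round of the game** (from the two pointwise stubs): blow up the admissible centre `Z`
(`exists_isBlowup`; the blow-up is proper, and — the reduced ideal of `Z` being nonzero — integral and
birational, hence dominant), assemble the new state from the pointwise data over / off the centre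
(`GameState.ofPointData`), and read off the round contract. [folklore] -/
theorem stub_gameRound (p : ℕ) (hp : p.Prime) (k : Type) [Field k] [CharP k p]
    (V₀ : Scheme.{0}) [IsIntegral V₀] (f₀ : V₀ ⟶ Spec (.of k)) (L : Type) [Field L]
    [Algebra V₀.functionField L] [LocallyOfFiniteType f₀] [QuasiCompact f₀]
    (hdeg : Module.finrank V₀.functionField L = p)
    (V : Scheme.{0}) [IsIntegral V] (π : V ⟶ V₀) [IsDominant π] [IsProper π] (hbir : IsBirational π)
    (S : GameState p V₀ L V π) (Z : Set V) (hZ : IsClosed Z)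
    (I : ∀ v : V, v ∈ Z → Finset (Fin (S.d v))) (hadm : S.Admissible Z hZ I) :
    ∃ (V' : Scheme.{0}) (_ : IsIntegral V') (φ : V' ⟶ V) (_ : IsDominant (φ ≫ π)) (_ : IsProper φ),
      IsBirational φ ∧ ∃ S' : GameState p V₀ L V' (φ ≫ π), S.RoundSpec Z hZ I φ S' := by
  classical
  set C := Scheme.IdealSheafData.vanishingIdeal (⟨Z, hZ⟩ : Closeds V) with hC
  -- the blow-up, proper
  haveI : LocallyOfFiniteType (π ≫ f₀) := inferInstance
  haveI : IsLocallyNoetherian V := LocallyOfFiniteType.isLocallyNoetherian (π ≫ f₀)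
  obtain ⟨V', φ, hφ⟩ := exists_isBlowup V C
  haveI : IsProper φ := hφ.isProper
  -- the centre ideal is nonzero: at a point of `Z` its stalk contains a coordinate, and `Z ≠ V` otherwise
  have hCne : C ≠ ⊥ := by
    intro hbot
    obtain ⟨v⟩ := (inferInstance : Nonempty V)
    have hv : v ∈ Z := by
      have h1 : v ∈ ((C.support : Closeds V) : Set V) := by rw [hbot, Scheme.IdealSheafData.support_bot]; trivial
      rwa [hC, Scheme.IdealSheafData.coe_support_vanishingIdeal] at h1
    obtain ⟨i, hi⟩ := Finset.card_pos.mp (lt_of_lt_of_le (by norm_num) (hadm.two_le v hv))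
    have hmem : S.u v i ∈ stalkIdeal C v := by
      rw [hadm.stalkIdeal_eq v hv]
      exact Ideal.subset_span ⟨i, hi, rfl⟩
    have hzero : S.u v i = 0 := by
      have h2 : stalkIdeal C v = ⊥ := by
        rw [hbot]
        obtain ⟨U, hU, hxU, -⟩ :=
          exists_isAffineOpen_mem_and_subset (X := V) (x := v) (U := ⊤) (Opens.mem_top v)
        rw [stalkIdeal_eq_map_germ _ ⟨U, hU⟩ hxU, Scheme.IdealSheafData.ideal_bot]
        simp
      rw [h2] at hmem
      exact hmem
    haveI := S.isRegular v
    exact (isRsopPart_comp_of_rsop (S.spanFinrank_eq v) (S.u v) (S.span_u v) (fun _ : Fin 1 => i)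
      (fun _ _ _ => Subsingleton.elim _ _)).ne_zero 0 hzero
  haveI hint : IsIntegral V' := hφ.isIntegral hCne
  have hbirφ : IsBirational φ := hφ.isBirational' hCne
  haveI : IsDominant φ := hbirφ.isDominant
  haveI hdom : IsDominant (φ ≫ π) := inferInstance
  -- pointwise data
  let P : ∀ x : V', GameState.PointData p V₀ L V' (φ ≫ π)
      (S.E.map (strictTransformIdeal φ C) ++ [C.comap φ]) x := fun x =>
    if hx : φ x ∈ Z then
      (stub_gameRoundOver p hp k V₀ f₀ L hdeg V π hbir S Z hZ I hadm V' φ hφ x hx).choose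
    else (stub_gameRoundOff p hp k V₀ f₀ L hdeg V π hbir S Z hZ I hadm V' φ hφ x hx).choose
  have hPover : ∀ x (hx : φ x ∈ Z), P x =
      (stub_gameRoundOver p hp k V₀ f₀ L hdeg V π hbir S Z hZ I hadm V' φ hφ x hx).choose :=
    fun x hx => dif_pos hx
  have hPoff : ∀ x (hx : φ x ∉ Z), P x =
      (stub_gameRoundOff p hp k V₀ f₀ L hdeg V π hbir S Z hZ I hadm V' φ hφ x hx).choose :=
    fun x hx => dif_neg hx
  refine ⟨V', hint, φ, hdom, inferInstance, hbirφ, GameState.ofPointData _ P, ?_⟩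
  refine ⟨rfl, ?_, ?_, ?_, ?_, ?_, ?_, ?_⟩
  · intro x hx
    rw [GameState.mOld_ofPointData, hPoff x hx]
    exact (stub_gameRoundOff p hp k V₀ f₀ L hdeg V π hbir S Z hZ I hadm V' φ hφ x hx).choose_spec.1
  · intro x hx D hD
    rw [GameState.chargedAt_ofPointData, hPoff x hx]
    exact (stub_gameRoundOff p hp k V₀ f₀ L hdeg V π hbir S Z hZ I hadm V' φ hφ x hx).choose_spec.2.1 D hD
  · intro x hx
    rw [GameState.chargedAt_ofPointData, hPoff x hx]
    exact (stub_gameRoundOff p hp k V₀ f₀ L hdeg V π hbir S Z hZ I hadm V' φ hφ x hx).choose_spec.2.2.1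
  · intro x hx D hD hch
    rw [GameState.Nval_ofPointData, hPoff x hx]
    exact (stub_gameRoundOff p hp k V₀ f₀ L hdeg V π hbir S Z hZ I hadm V' φ hφ x hx).choose_spec.2.2.2
      D hD hch
  · intro x hx hI
    rw [GameState.mOld_ofPointData, hPover x hx]
    exact (stub_gameRoundOver p hp k V₀ f₀ L hdeg V π hbir S Z hZ I hadm V' φ hφ x hx).choose_spec.2.1 hI
  · intro x hx
    rw [GameState.mOld_ofPointData, hPover x hx]
    exact (stub_gameRoundOver p hp k V₀ f₀ L hdeg V π hbir S Z hZ I hadm V' φ hφ x hx).choose_spec.1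
  · intro x hx D₀ h1 hch hI hm
    rw [GameState.mOld_ofPointData, hPover x hx] at hm
    have h := (stub_gameRoundOver p hp k V₀ f₀ L hdeg V π hbir S Z hZ I hadm V' φ hφ x hx).choose_spec.2.2
      D₀ h1 hch hI hm
    simp only [GameState.chargedAt_ofPointData, GameState.Nval_ofPointData, hPover x hx]
    exact h


/-! ## The game: an END STATE from the pointwise clean data -/

/-- **The exceptionalisation game, assembled**: a pointwise log-clean pair reaches an END STATE on some proper birational
regular model. Start from the initial state (`stub_gameInit`); PHASE 1, by induction on the maximal number `μ` of old
charged components through a point: while `μ ≥ 2` blow up the closed centre `{mOld = μ}` (`stub_gameCentre1`,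
`stub_gameRound`) — upstairs `mOld < μ` everywhere (`RoundSpec.p1` over the centre, `off_mOld` elsewhere); PHASE 2, by
induction on the potential `Φ`: while some exceptional divisor `D₀` is charged at a point with `mOld = 1`, blow up its bad
locus `W D₀` (`stub_gameCentre2`, `stub_gameRound`) — `mOld ≤ 1` is kept and `Φ` drops (`GameState.Φ_lt_of_roundSpec`).
[folklore] -/
theorem endState_exists (p : ℕ) (hp : p.Prime) (k : Type) [Field k] [CharP k p]
    (V : Scheme.{0}) [IsIntegral V] (f : V ⟶ Spec (.of k)) (L : Type) [Field L]
    [Algebra V.functionField L] [IsSeparated f] [LocallyOfFiniteType f] [QuasiCompact f]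
    (hVreg : Scheme.IsRegular V) [IsPurelyInseparable V.functionField L]
    (hdeg : Module.finrank V.functionField L = p)
    (hclean : ∀ v : V, ∃ (y : L) (g : V.functionField),
      y ∉ Set.range (algebraMap V.functionField L) ∧ algebraMap V.functionField L g = y ^ p ∧
      ((∃ (d m : ℕ) (hmd : m ≤ d) (t : Fin d → V.presheaf.stalk v) (a : Fin m → ℕ),
          Ideal.span (Set.range t) = IsLocalRing.maximalIdeal (V.presheaf.stalk v) ∧
          ringKrullDim (V.presheaf.stalk v) = (d : WithBot ℕ∞) ∧ 0 < m ∧ (∀ i, ¬ p ∣ a i) ∧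
          g = ∏ i : Fin m,
            (algebraMap (V.presheaf.stalk v) V.functionField (t (Fin.castLE hmd i))) ^ (a i)) ∨
        (∃ u₀ : V.presheaf.stalk v, IsUnit u₀ ∧
          g = algebraMap (V.presheaf.stalk v) V.functionField u₀ ∧
          ((∀ c : V.presheaf.stalk v,
              u₀ - c ^ p ∉ IsLocalRing.maximalIdeal (V.presheaf.stalk v)) ∨
            (∃ c : V.presheaf.stalk v,
              u₀ - c ^ p ∈ IsLocalRing.maximalIdeal (V.presheaf.stalk v) ∧
              u₀ - c ^ p ∉ IsLocalRing.maximalIdeal (V.presheaf.stalk v) ^ 2))))) :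
    ∃ (V' : Scheme.{0}) (_ : IsIntegral V') (π' : V' ⟶ V) (_ : IsDominant π') (_ : IsProper π'),
      IsBirational π' ∧ ∃ S : GameState p V L V' π', S.EndCond := by
  classical
  have hp1 : 1 ≤ p := hp.one_lt.le
  -- PHASE 1: make `mOld ≤ 1`
  have phase1 : ∀ (n : ℕ) (W : Scheme.{0}) [IsIntegral W] (ρ : W ⟶ V) [IsDominant ρ] [IsProper ρ],
      IsBirational ρ → ∀ T : GameState p V L W ρ, (∀ v, T.mOld v ≤ n) →
      ∃ (W₁ : Scheme.{0}) (_ : IsIntegral W₁) (ρ₁ : W₁ ⟶ V) (_ : IsDominant ρ₁) (_ : IsProper ρ₁),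
        IsBirational ρ₁ ∧ ∃ T₁ : GameState p V L W₁ ρ₁, ∀ v, T₁.mOld v ≤ 1 := by
    intro n
    induction n with
    | zero =>
      intro W _ ρ _ _ hρ T hT
      exact ⟨W, inferInstance, ρ, inferInstance, inferInstance, hρ, T, fun v => (hT v).trans zero_le_one⟩
    | succ n ih =>
      intro W _ ρ _ _ hρ T hT
      by_cases hn : n + 1 ≤ 1
      · exact ⟨W, inferInstance, ρ, inferInstance, inferInstance, hρ, T, fun v => (hT v).trans hn⟩
      by_cases hall : ∀ v, T.mOld v ≤ n
      · exact ih W ρ hρ T hall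
      have hμ : 2 ≤ n + 1 := by omega
      obtain ⟨hZ, hadm⟩ := stub_gameCentre1 p hp k V f L hdeg W ρ hρ T (n + 1) hμ hT
      obtain ⟨W', hW'int, φ, hdom, hprop, hφbir, T', hRS⟩ :=
        stub_gameRound p hp k V f L hdeg W ρ hρ T _ hZ _ hadm
      have hT' : ∀ x, T'.mOld x ≤ n := by
        intro x
        by_cases hx : φ x ∈ {v | T.mOld v = n + 1}
        · have h1 := hRS.p1 x hx rfl
          have h2 := hT (φ x)
          omega
        · have h1 := hRS.off_mOld x hx
          have h2 := hT (φ x)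
          have h3 : T.mOld (φ x) ≠ n + 1 := hx
          omega
      obtain ⟨W₁, hW₁, ρ₁, hd₁, hp₁, hρ₁, T₁, hT₁⟩ :=
        ih W' (φ ≫ ρ) (ComponentGluing.IsBirational.comp hφbir hρ) T' hT'
      exact ⟨W₁, hW₁, ρ₁, hd₁, hp₁, hρ₁, T₁, hT₁⟩
  -- PHASE 2: make the end condition hold
  have phase2 : ∀ (n : ℕ) (W : Scheme.{0}) [IsIntegral W] (ρ : W ⟶ V) [IsDominant ρ] [IsProper ρ],
      IsBirational ρ → ∀ T : GameState p V L W ρ, (∀ v, T.mOld v ≤ 1) → T.Φ ≤ n →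
      ∃ (W₁ : Scheme.{0}) (_ : IsIntegral W₁) (ρ₁ : W₁ ⟶ V) (_ : IsDominant ρ₁) (_ : IsProper ρ₁),
        IsBirational ρ₁ ∧ ∃ T₁ : GameState p V L W₁ ρ₁, T₁.EndCond := by
    intro n
    induction n with
    | zero =>
      intro W _ ρ _ _ hρ T h1 hΦ
      by_cases hend : T.EndCond
      · exact ⟨W, inferInstance, ρ, inferInstance, inferInstance, hρ, T, hend⟩
      exfalso
      obtain ⟨v, D₀, hv1, hch⟩ := T.exists_chargedAt_of_not_endCond h1 hend
      have hD₀ : D₀ ∈ T.E := T.mem_E_of_chargedAt hch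
      obtain ⟨hZ, hadm⟩ := stub_gameCentre2 p hp k V f L hdeg W ρ hρ T h1 D₀ hD₀
      obtain ⟨W', hW'int, φ, hdom, hprop, hφbir, T', hRS⟩ :=
        stub_gameRound p hp k V f L hdeg W ρ hρ T _ hZ _ hadm
      have hlt := T.Φ_lt_of_roundSpec hp1 h1 D₀ hD₀ ⟨v, hv1, hch⟩ hZ φ T' hRS
      omega
    | succ n ih =>
      intro W _ ρ _ _ hρ T h1 hΦ
      by_cases hend : T.EndCond
      · exact ⟨W, inferInstance, ρ, inferInstance, inferInstance, hρ, T, hend⟩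
      obtain ⟨v, D₀, hv1, hch⟩ := T.exists_chargedAt_of_not_endCond h1 hend
      have hD₀ : D₀ ∈ T.E := T.mem_E_of_chargedAt hch
      obtain ⟨hZ, hadm⟩ := stub_gameCentre2 p hp k V f L hdeg W ρ hρ T h1 D₀ hD₀
      obtain ⟨W', hW'int, φ, hdom, hprop, hφbir, T', hRS⟩ :=
        stub_gameRound p hp k V f L hdeg W ρ hρ T _ hZ _ hadm
      have hlt := T.Φ_lt_of_roundSpec hp1 h1 D₀ hD₀ ⟨v, hv1, hch⟩ hZ φ T' hRS
      have h1' : ∀ x, T'.mOld x ≤ 1 := by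
        intro x
        by_cases hx : φ x ∈ T.W D₀
        · exact (hRS.over_mOld_le x hx).trans (h1 (φ x))
        · rw [hRS.off_mOld x hx]; exact h1 (φ x)
      obtain ⟨W₁, hW₁, ρ₁, hd₁, hp₁, hρ₁, T₁, hT₁⟩ :=
        ih W' (φ ≫ ρ) (ComponentGluing.IsBirational.comp hφbir hρ) T' h1' (by omega)
      exact ⟨W₁, hW₁, ρ₁, hd₁, hp₁, hρ₁, T₁, hT₁⟩
  -- run the two phases from the initial state
  obtain ⟨S₀, -, n₀, hn₀⟩ := stub_gameInit p hp k V f L hVreg hdeg hclean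
  have hbir0 : IsBirational (𝟙 V) := ⟨⊤, by simp [dense_univ], by simp [dense_univ], inferInstance⟩
  have hS₀ : ∀ v, S₀.mOld v ≤ n₀ := fun v =>
    ((Finset.card_le_univ _).trans (by rw [Fintype.card_fin])).trans (hn₀ v)
  obtain ⟨W₁, hW₁, ρ₁, hd₁, hp₁, hρ₁, T₁, hT₁⟩ := phase1 n₀ V (𝟙 V) hbir0 S₀ hS₀
  obtain ⟨W₂, hW₂, ρ₂, hd₂, hp₂, hρ₂, T₂, hT₂⟩ := phase2 T₁.Φ W₁ ρ₁ hρ₁ T₁ hT₁ le_rfl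
  exact ⟨W₂, hW₂, ρ₂, hd₂, hp₂, hρ₂, T₂, hT₂⟩

/-! ## The crux, conditionally on Kato 1994 (10.4) -/


/-- **The crux `CleanModelsSuffice` modulo Kato 1994 (10.4)** — concludes `CleanModelsSuffice` BY NAME from the
named fact `Kato1994_logRegularScheme_hasResolution` (CONDITIONAL result): the game reaches an end state on a proper
birational regular model (`endState_exists`), Kato (10.4) resolves the normalisation of the base from there
(`stub_gameEndResolves`), `CleanResolves.cleanResolves_of_self` turns this `π = 𝟙` case into the support
`CleanResolves`, and pAlteration's PROVED per-prime frame (`palterationThesisAt_iff_resolutionInChar`,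
`picoverAt_of_degPAt`) concludes. [cite: Kato1994, (10.4)] -/
theorem CleanModelsSuffice_of_kato (hK : Kato1994_logRegularScheme_hasResolution.{0}) :
    Summit.ResolutionOfSingularities.ResolutionOfSingularities.Theses.RadicialJung.CleanModelsSuffice := by
  -- (1) the `π = 𝟙` case of `CleanResolves`
  have hSelf : ∀ p : ℕ, p.Prime → ∀ (k : Type) [Field k] [CharP k p] (V : Scheme.{0}) [IsIntegral V]
      (f : V ⟶ Spec (.of k)) (L : Type) [Field L] [Algebra V.functionField L],
      IsSeparated f → LocallyOfFiniteType f → QuasiCompact f → Scheme.IsRegular V →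
      IsPurelyInseparable V.functionField L → Module.finrank V.functionField L = p →
      (∀ v : V, ∃ (y : L) (g : V.functionField), y ∉ Set.range (algebraMap V.functionField L) ∧
        algebraMap V.functionField L g = y ^ p ∧
        ((∃ (d m : ℕ) (hmd : m ≤ d) (t : Fin d → V.presheaf.stalk v) (a : Fin m → ℕ),
            Ideal.span (Set.range t) = IsLocalRing.maximalIdeal (V.presheaf.stalk v) ∧
            ringKrullDim (V.presheaf.stalk v) = (d : WithBot ℕ∞) ∧ 0 < m ∧ (∀ i, ¬ p ∣ a i) ∧
            g = ∏ i : Fin m,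
              (algebraMap (V.presheaf.stalk v) V.functionField (t (Fin.castLE hmd i))) ^ (a i)) ∨
          (∃ u₀ : V.presheaf.stalk v, IsUnit u₀ ∧
            g = algebraMap (V.presheaf.stalk v) V.functionField u₀ ∧
            ((∀ c : V.presheaf.stalk v,
                u₀ - c ^ p ∉ IsLocalRing.maximalIdeal (V.presheaf.stalk v)) ∨
              (∃ c : V.presheaf.stalk v,
                u₀ - c ^ p ∈ IsLocalRing.maximalIdeal (V.presheaf.stalk v) ∧
                u₀ - c ^ p ∉ IsLocalRing.maximalIdeal (V.presheaf.stalk v) ^ 2))))) →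
      Scheme.HasResolution (normalizationIn V L) := by
    intro p hp k _ _ V _ f L _ _ hsep hloc hqc hVreg hPI hdeg hclean
    haveI := hsep; haveI := hloc; haveI := hqc; haveI := hPI
    obtain ⟨V', hV'int, π', hdom, hprop, hbir, S, hend⟩ := endState_exists p hp k V f L hVreg hdeg hclean
    haveI := hV'int; haveI := hdom; haveI := hprop
    exact stub_gameEndResolves hK p hp k V f L hdeg V' π' hbir S hend
  -- (2) `CleanResolves` from its `π = 𝟙` case (proved in tree)
  have hCR : Summit.ResolutionOfSingularities.ResolutionOfSingularities.Theses.RadicialJung.CleanResolves :=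
    CleanResolves.cleanResolves_of_self hSelf
  -- (3) pAlteration's PROVED per-prime frame
  intro p hp hPI hCM
  have hDegP : ∀ (k : Type) [Field k] [CharP k p] (W : Scheme.{0}) [IsIntegral W]
      (f : W ⟶ Spec (.of k)) (L : Type) [Field L] [Algebra W.functionField L],
      IsSeparated f → LocallyOfFiniteType f → QuasiCompact f → Scheme.IsRegular W →
      IsPurelyInseparable W.functionField L → Module.finrank W.functionField L = p →
      Scheme.HasResolution (normalizationIn W L) := by
    intro k _ _ W _ f L _ _ hs hl hq hr hpi hd
    obtain ⟨V, π, hVi, hdom, hV⟩ := hCM k W f L hs hl hq hr hpi hd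
    exact hCR p hp k W f L hs hl hq hr hpi hd V π hV
  exact (palterationThesisAt_iff_resolutionInChar p hp).mp ⟨hPI, picoverAt_of_degPAt p hp hDegP⟩

/-! ## Skeleton bookkeeping: the named fact as the last stub, and the crux by name -/

/-- STUB (NAMED FACT, by design): Kato 1994 (10.4) — a quasi-compact log regular scheme with Zariski fs
charts has a resolution (vendored `Kato1994_logRegularScheme_hasResolution`). [cite: Kato1994, (10.4)] -/
theorem stub_Kato10_4 : Kato1994_logRegularScheme_hasResolution.{0} := by
  sorry

/-- **The crux from the stubs** — concludes `CleanModelsSuffice` BY NAME (from `CleanModelsSuffice_of_kato` and the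
one remaining stub, the named fact Kato (10.4)). [folklore] -/
theorem CleanModelsSuffice_of :
    Summit.ResolutionOfSingularities.ResolutionOfSingularities.Theses.RadicialJung.CleanModelsSuffice :=
  CleanModelsSuffice_of_kato stub_Kato10_4

end Summit.ResolutionOfSingularities.ResolutionOfSingularities.Theorems.RadicialJung.CleanModelsSuffice

end
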